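import Summits.BirchSwinnertonDyer.BirchSwinnertonDyer.Theorems.ByReductionTypeAtTwoSupersingularFlatBlindPinchOfAvatar
import HarnessLib

/-!
# D-imc-90 — THE L-VALUE BIT: the twist-point pinch at `2` needs no power series
(cell `bsd-f1-sign2`, seat `-imc` g36, LENS Iwasawa-main-conjecture; crux `SupersingularRankZeroAtTwo`, item
stmt-BirchSwinnertonDyer-19097, registered line `odd_blind_package` v2.17 b90024f4, pinch kernel `bsdp_two_of_twistPinch`)

WHAT.  In v2.17 the pinch branch of stub 5/5 (`LowerBoundOffGenericOddAtTwo`) is certified per curve by an AVATAR `G ∈ Λ = ℤ₂⟦T⟧` of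
`ϖ·L♭` (newform `f`, period ratio `ϖ`, Sprung pair `(L♯, L♭)`, `ι G = C(ϖ)·ι L♭`) carrying the two TABLE BITS `μ(G) = 0 ∧ λ(G) ≤ 1`,
plus a curve `W₂ ≅ E^{(2)}` with `corank Sel_{2^∞}(W₂) ≥ 2`.  Inside the kernel the blind zero `(T+2) ∣ ξ` (K87-C ★★ p827897) and the
Kato half `ξ ∣ G` are derived, so `(T+2) ∣ G` holds there.  THIS FILE: given `(T+2) ∣ G`, the table bits are EQUIVALENT to one
2-adic valuation of the constant term — `4 ∤ G(0)` (K90-Λ: `G = (T+2)·H`, `2 ∤ H(0)` ⟹ `H ∈ Λˣ` ⟹ `μ(G) = 0`, `λ(G) = λ(T+2) = 1`;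
K90-Λ′: conversely `μ(G) = 0 ∧ λ(G) ≤ 1 ∧ (T+2) ∣ G ⟹ 4 ∤ G(0)`), and `G(0) = c♭·t` with `t = L(E,1)/Ω_E`, `c♭ = −a₂² + 2a₂ + 1 ∈
{1, −7}` ODD (W-88 ★★ p830132's bookkeeping, `constantCoeff_avatar`), so `4 ∤ G(0) ⟺ v₂(L(E,1)/Ω_E) ≤ 1` (K90-V: `2ⁿ ∣ x` in `ℤ₂` and
`x = q ∈ ℚˣ` ⟹ `n ≤ v₂(q)`).  CONSEQUENCES: (K90-P) `bsdp_two_of_flatBlindPinch_of_lvalue` = the pinch with the table bits replaced by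
the MODULARITY-FREE, AVATAR-FREE L-VALUE BIT `v₂(L(E,1)/Ω_E) ≤ 1` (read on `Ω_E = W.realPeriodRat`, the Néron period WITH components);
(K90-C) `one_le_padicValRat_lvalue_of_blindZero`: the blind zero forces the congruence `2 ∣ L(E,1)/Ω_E` — on the named residual
R-imc-76 (`corank Sel_{2^∞}(E^{(2)}) ≥ 2`) this is a CHECKABLE PREDICTION of the line (R-90: `v₂(L/Ω) ≥ 1` on 47/47 sampled rows, and
`λ♭ = 1 ⟺ v₂(L/Ω) = 1` on 616/616 SF2 rows of pinch87.tsv).  A v2.18 option for the LEAD: key the pinch certificate of stub 5/5 on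
`∃ W₂ ≅ E^{(2)}, corank ≥ 2 ∧ v₂(L(E,1)/Ω_E) ≤ 1` — no `f`, `ϖ`, `(L♯, L♭)`, `G` binders, no `ι`-injectivity (the kernel instantiates the
Kato half at `hPub`'s own newform as `bsdp_two_of_genericOdd` does).

HONESTY.  Λ-algebra + bookkeeping over print-shaped inputs (theorems only: no definition, no named fact, no instance, no `sorry`; axioms the
standard trio).  Beyond-print theorem: no.  It closes no registered stub; 19097 OPEN on 5 registered stubs (v2.17); BSD proved for no curve.
[cite: Washington1997, §7.1 (μ, λ, distinguished polynomials)] [cite: GreenbergVatsal2000, p. 4] [cite: Sprung2017, Thm. 1.12, Cor. 4.4]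
-/

open scoped Classical MatrixGroups ModularForm NumberField
open NumberField IsDedekindDomain CongruenceSubgroup WeierstrassCurve PowerSeries
open Literature.NumberTheory.EllipticCurves Literature.NumberTheory.EllipticCurves.IwasawaDual
  Literature.NumberTheory.EllipticCurves.Sprung2012 Literature.NumberTheory.EllipticCurves.Sprung2017
  Literature.NumberTheory.EllipticCurves.ModularForms
  Literature.NumberTheory.EllipticCurves.Rank1Residual Literature.NumberTheory.EllipticCurves.Rank1Residual.Typed
  Literature.NumberTheory.EllipticCurves.Kobayashi2003 Literature.NumberTheory.GaloisRepresentations ZpExtension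
  Literature.NumberTheory.EllipticCurves.AcSigned
open Summit.BirchSwinnertonDyer.Rank1Residual Summit.BirchSwinnertonDyer.Rank1Residual.Supersingular
  Summit.BirchSwinnertonDyer.Rank1Residual.X5.O1 Summit.BirchSwinnertonDyer.Rank1Residual.X1.MuLambda
  Summit.BirchSwinnertonDyer.BirchSwinnertonDyer.Theorems

set_option linter.dupNamespace false
set_option autoImplicit false

namespace Summit.BirchSwinnertonDyer.BirchSwinnertonDyer.Cruxes.SupersingularRankZeroAtTwo.D90

/-! ## K90-V / K90-U — two `ℤ_p` facts -/

/-- **K90-V.** `pⁿ ∣ x` in `ℤ_p` and `(x : ℚ_p) = q` with `q ∈ ℚˣ` ⟹ `n ≤ v_p(q)`. [folklore] -/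
theorem le_padicValRat_of_pow_dvd {p : ℕ} [Fact p.Prime] {x : ℤ_[p]} {q : ℚ} (hq : q ≠ 0)
    (hx : (x : ℚ_[p]) = ((q : ℚ) : ℚ_[p])) {n : ℕ} (hn : (p : ℤ_[p]) ^ n ∣ x) : (n : ℤ) ≤ padicValRat p q := by
  have h1 : ‖x‖ ≤ (p : ℝ) ^ (-n : ℤ) :=
    (PadicInt.norm_le_pow_iff_mem_span_pow x n).mpr (Ideal.mem_span_singleton.mpr hn)
  rw [PadicInt.norm_def, hx, Padic.eq_padicNorm, padicNorm.eq_zpow_of_nonzero hq] at h1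
  push_cast at h1
  have hp : (1 : ℝ) < p := by exact_mod_cast (Fact.out : p.Prime).one_lt
  have h2 := (zpow_le_zpow_iff_right₀ hp).mp h1
  omega

/-- **K90-U.** In `ℤ_p`, `p ∤ x` ⟹ `x` is a unit. [folklore] -/
theorem isUnit_of_not_dvd {p : ℕ} [Fact p.Prime] {x : ℤ_[p]} (hx : ¬ (p : ℤ_[p]) ∣ x) : IsUnit x := by
  by_contra hu
  apply hx
  have hm : x ∈ IsLocalRing.maximalIdeal ℤ_[p] := hu
  rw [PadicInt.maximalIdeal_eq_span_p, Ideal.mem_span_singleton] at hm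
  exact hm

/-- `2` is not a unit of `ℤ₂`. [folklore] -/
theorem not_isUnit_two : ¬ IsUnit (2 : ℤ_[2]) := by
  rw [PadicInt.not_isUnit_iff]
  have h : ‖((2 : ℕ) : ℤ_[2])‖ < 1 := by rw [PadicInt.norm_p]; norm_num
  simpa using h

/-! ## K90-Λ — the L-value bit pinch in `Λ = ℤ₂⟦T⟧` -/

/-- The constant term of `(T+2)·H` is `2·H(0)`. [folklore] -/
theorem constantCoeff_X_add_C_two_mul (H : IwasawaAlgebra 2) :
    constantCoeff ((PowerSeries.X + PowerSeries.C (2 : ℤ_[2]) : IwasawaAlgebra 2) * H) = 2 * constantCoeff H := by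
  rw [map_mul, map_add, constantCoeff_X, constantCoeff_C, zero_add]

/-- **K90-Λ — THE L-VALUE BIT PINCH IN `Λ`.**  `(T+2) ∣ G` and `4 ∤ G(0)` ⟹ `μ(G) = 0 ∧ λ(G) = 1`:
`G = (T+2)·H` with `G(0) = 2·H(0)`, so `2 ∤ H(0)`, `H(0) ∈ ℤ₂ˣ`, `H ∈ Λˣ`, and `μ`, `λ` are additive with `μ(T+2) = 0`, `λ(T+2) = 1`,
`μ(H) = λ(H) = 0`. [cite: Washington1997, §7.1] -/
theorem mu_eq_zero_and_lam_eq_one_of_X_add_C_two_dvd_of_not_four_dvd {G : IwasawaAlgebra 2}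
    (hZ : (PowerSeries.X + PowerSeries.C (2 : ℤ_[2]) : IwasawaAlgebra 2) ∣ G) (h4 : ¬ (4 : ℤ_[2]) ∣ constantCoeff G) :
    mu G = 0 ∧ lam G = 1 := by
  obtain ⟨H, rfl⟩ := hZ
  have h2 : ¬ (2 : ℤ_[2]) ∣ constantCoeff H := by
    rintro ⟨c, hc⟩
    exact h4 ⟨c, by rw [constantCoeff_X_add_C_two_mul, hc]; ring⟩
  have hu : IsUnit (constantCoeff H) := isUnit_of_not_dvd (p := 2) (by exact_mod_cast h2)
  have hHu : IsUnit H := isUnit_iff_constantCoeff.mpr hu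
  obtain ⟨hHne, hmuH, hlamH⟩ := (isUnit_iff_mu_eq_zero_and_lam_eq_zero H).mp hHu
  refine ⟨?_, ?_⟩
  · rw [mu_mul FlatBlindPinch.X_add_C_two_ne_zero hHne, hmuH, add_zero]
    exact AlignedTransportAtTwoTwoFixedPoints.mu_X_add_C_two_and_pfree.1
  · rw [lam_mul FlatBlindPinch.X_add_C_two_ne_zero hHne, hlamH, add_zero]
    exact AlignedTransportAtTwoTwoFixedPoints.lam_X_add_C_two

/-- **K90-Λ′ — the converse: the two certificates are EQUIVALENT given the blind zero.**  `G ≠ 0`, `(T+2) ∣ G`, `μ(G) = 0`,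
`λ(G) ≤ 1` ⟹ `4 ∤ G(0)` (`λ(H) = 0 = μ(H)` ⟹ `H ∈ Λˣ` ⟹ `2 ∤ H(0)` ⟹ `4 ∤ 2·H(0)`). [cite: Washington1997, §7.1] -/
theorem not_four_dvd_of_mu_eq_zero_of_lam_le_one {G : IwasawaAlgebra 2} (hG : G ≠ 0)
    (hZ : (PowerSeries.X + PowerSeries.C (2 : ℤ_[2]) : IwasawaAlgebra 2) ∣ G) (hμ : mu G = 0) (hlam : lam G ≤ 1) :
    ¬ (4 : ℤ_[2]) ∣ constantCoeff G := by
  obtain ⟨H, rfl⟩ := hZ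
  have hHne : H ≠ 0 := by rintro rfl; exact hG (mul_zero _)
  have hlamX : lam (PowerSeries.X + PowerSeries.C (2 : ℤ_[2]) : IwasawaAlgebra 2) = 1 := AlignedTransportAtTwoTwoFixedPoints.lam_X_add_C_two
  have hmuX : mu (PowerSeries.X + PowerSeries.C (2 : ℤ_[2]) : IwasawaAlgebra 2) = 0 := AlignedTransportAtTwoTwoFixedPoints.mu_X_add_C_two_and_pfree.1
  have hlamH : lam H = 0 := by
    rw [lam_mul FlatBlindPinch.X_add_C_two_ne_zero hHne, hlamX] at hlam
    omega
  have hmuH : mu H = 0 := by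
    rw [mu_mul FlatBlindPinch.X_add_C_two_ne_zero hHne, hmuX] at hμ
    omega
  have hHu : IsUnit H := (isUnit_iff_mu_eq_zero_and_lam_eq_zero H).mpr ⟨hHne, hmuH, hlamH⟩
  have hu : IsUnit (constantCoeff H) := isUnit_iff_constantCoeff.mp hHu
  rintro ⟨c, hc⟩
  have h2c : constantCoeff H = 2 * c := by
    have h' : (2 : ℤ_[2]) * constantCoeff H = 2 * (2 * c) := by rw [← constantCoeff_X_add_C_two_mul, hc]; ring
    exact mul_left_cancel₀ two_ne_zero h'
  rw [h2c] at hu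
  exact not_isUnit_two (isUnit_of_mul_isUnit_left hu)

/-! ## The avatar's constant term and the two consequences for the line -/

/-- **The constant term of an avatar.**  For the newform `f` of `E = W` (good supersingular at `2`), its period ratio `ϖ`, a Sprung pair
`(L♯, L♭)` at `2` and `G ∈ Λ` with `ι G = C(ϖ)·ι L♭`: `G(0) = c♭·t` in `ℚ₂` with `t = L(E,1)/Ω_E ∈ ℚ` and `c♭ = −a₂² + 2a₂ + 1 ∈ {1, −7}`.
(W-88 ★★ p830132's bookkeeping, isolated.) [cite: Sprung2017, Thm. 1.12, Cor. 4.4] -/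
theorem constantCoeff_avatar (W : WeierstrassCurve ℚ) [W.IsElliptic] [W.IsGloballyMinimal] (hss : GoodSS W 2)
    [NeZero (W.conductorNorm ℤ)] {f : CuspForm (Gamma0 (W.conductorNorm ℤ)) 2} (hf : IsNewformOf W f)
    {ϖ : ℚ} (hϖ : (ϖ : ℝ) * W.realPeriodRat = plusPeriod f)
    {Ls Lf : IwasawaAlgebra 2} (hSP : IsSprungPair f 2 (W.frobeniusTrace 2) Ls Lf)
    {G : IwasawaAlgebra 2} (hG : iwasawaToPowerSeries 2 G = PowerSeries.C (ϖ : ℚ_[2]) * iwasawaToPowerSeries 2 Lf) :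
    ∃ t cf : ℚ, W.entireLFunction 1 / (W.realPeriodRat : ℂ) = ((t : ℚ) : ℂ) ∧
      ((PowerSeries.constantCoeff G : ℤ_[2]) : ℚ_[2]) = (((cf * t : ℚ)) : ℚ_[2]) ∧ (cf = 1 ∨ cf = -7) := by
  have hΩpos : 0 < W.realPeriodRat := W.realPeriodRat_pos_holds
  set s₀ : ℚ := ratPlusSymbol f 0 with hs_def
  set t : ℚ := ϖ * s₀ with ht_def
  have ht : W.entireLFunction 1 / (W.realPeriodRat : ℂ) = ((t : ℚ) : ℂ) := by
    rw [hf.entireLFunction_one_eq, ← hϖ, div_eq_iff (Complex.ofReal_ne_zero.mpr hΩpos.ne'), ht_def]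
    push_cast
    ring
  set cf : ℚ := -(W.frobeniusTrace 2 : ℚ) ^ 2 + 2 * (W.frobeniusTrace 2) + 1 with hcf_def
  have hLf0 := constantCoeff_flat_two_of_isSprungPair_of_isNewformOf hf hss.1 hSP
  have hϖLf : (ϖ : ℚ_[2]) * ((PowerSeries.constantCoeff Lf : ℤ_[2]) : ℚ_[2]) = (((cf * t : ℚ)) : ℚ_[2]) := by
    rw [hLf0, ht_def, hcf_def]
    push_cast
    ring
  have hG0 : ((PowerSeries.constantCoeff G : ℤ_[2]) : ℚ_[2]) = (((cf * t : ℚ)) : ℚ_[2]) := by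
    have hc0 := congrArg PowerSeries.constantCoeff hG
    rw [map_mul PowerSeries.constantCoeff (PowerSeries.C (ϖ : ℚ_[2])), PowerSeries.constantCoeff_C,
      constantCoeff_iwasawaToPowerSeries, constantCoeff_iwasawaToPowerSeries, hϖLf] at hc0
    exact hc0
  have hcf1 : cf = 1 ∨ cf = -7 := by
    rcases frobeniusTrace_two_eq_zero_or W hss.1 hss.2 with h0 | h0 | h0
    · left; rw [hcf_def, h0]; norm_num
    · left; rw [hcf_def, h0]; norm_num
    · right; rw [hcf_def, h0]; norm_num
  exact ⟨t, cf, ht, hG0, hcf1⟩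

/-- `v₂(c♭) = 0` for `c♭ ∈ {1, −7}`. [folklore] -/
theorem padicValRat_cf_eq_zero {cf : ℚ} (hcf : cf = 1 ∨ cf = -7) : padicValRat 2 cf = 0 := by
  rcases hcf with h | h
  · rw [h]; exact padicValRat.one
  · rw [h, show (-7 : ℚ) = -((7 : ℕ) : ℚ) by norm_num, padicValRat.neg, padicValRat.of_nat]
    have h7 : padicValNat 2 7 = 0 := padicValNat.eq_zero_of_not_dvd (by norm_num)
    exact_mod_cast h7

/-- `t = L(E,1)/Ω_E` is determined by `W` (the defining equation pins it). [folklore] -/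
theorem lvalue_ratio_unique (W : WeierstrassCurve ℚ) [W.IsElliptic] {t t' : ℚ}
    (ht : W.entireLFunction 1 / (W.realPeriodRat : ℂ) = ((t : ℚ) : ℂ))
    (ht' : W.entireLFunction 1 / (W.realPeriodRat : ℂ) = ((t' : ℚ) : ℂ)) : t = t' := by
  have h := ht.symm.trans ht'
  exact_mod_cast h

/-- **K90-C — THE BLIND-ZERO CONGRUENCE `2 ∣ L(E,1)/Ω_E`.**  If the characteristic element `ξ` divides an avatar `G` of `ϖ·L♭` (the Kato
half) and carries the blind zero `(T+2) ∣ ξ` (K87-C, from `corank Sel_{2^∞}(E^{(2)}) ≥ 2`), then `2 ∣ G(0) = c♭·L(E,1)/Ω_E` with `c♭`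
odd, i.e. `1 ≤ v₂(L(E,1)/Ω_E)` whenever `L(E,1) ≠ 0`.  A checkable prediction of the line on the named residual R-imc-76.
[cite: GreenbergVatsal2000, p. 4] [cite: Sprung2017, Thm. 1.12, Cor. 4.4] -/
theorem one_le_padicValRat_lvalue_of_blindZero (W : WeierstrassCurve ℚ) [W.IsElliptic] [W.IsGloballyMinimal] (hss : GoodSS W 2)
    [NeZero (W.conductorNorm ℤ)] {f : CuspForm (Gamma0 (W.conductorNorm ℤ)) 2} (hf : IsNewformOf W f)
    {ϖ : ℚ} (hϖ : (ϖ : ℝ) * W.realPeriodRat = plusPeriod f)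
    {Ls Lf : IwasawaAlgebra 2} (hSP : IsSprungPair f 2 (W.frobeniusTrace 2) Ls Lf)
    {ξ G : IwasawaAlgebra 2} (hG : iwasawaToPowerSeries 2 G = PowerSeries.C (ϖ : ℚ_[2]) * iwasawaToPowerSeries 2 Lf)
    (hξG : ξ ∣ G) (hZ : (PowerSeries.X + PowerSeries.C (2 : ℤ_[2]) : IwasawaAlgebra 2) ∣ ξ)
    {t : ℚ} (ht : W.entireLFunction 1 / (W.realPeriodRat : ℂ) = ((t : ℚ) : ℂ)) (ht0 : t ≠ 0) : 1 ≤ padicValRat 2 t := by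
  obtain ⟨t', cf, ht', hG0, hcf⟩ := constantCoeff_avatar W hss hf hϖ hSP hG
  obtain rfl : t' = t := lvalue_ratio_unique W ht' ht
  have hcf0 : cf ≠ 0 := by rcases hcf with h | h <;> rw [h] <;> norm_num
  have h2G : ((2 : ℕ) : ℤ_[2]) ^ 1 ∣ constantCoeff G := by
    obtain ⟨H, hH⟩ := hZ.trans hξG
    refine ⟨constantCoeff H, ?_⟩
    rw [hH, constantCoeff_X_add_C_two_mul]
    push_cast
    ring
  have hv := le_padicValRat_of_pow_dvd (p := 2) (mul_ne_zero hcf0 ht0) hG0 h2G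
  rw [padicValRat.mul hcf0 ht0, padicValRat_cf_eq_zero hcf, zero_add] at hv
  exact_mod_cast hv

/-- **K90-P — THE L-VALUE BIT PINCH.**  `FlatBlindPinch.bsdp_two_of_flatBlindPinch_of_avatar` (W-88 ★★ p830132) with the two table bits
`μ(G) = 0`, `λ(G) ≤ 1` REPLACED by the single, modularity-free L-VALUE BIT `v₂(L(E,1)/Ω_E) ≤ 1` (for the `t ∈ ℚ` with
`L(E,1)/Ω_E = t`; `Ω_E = W.realPeriodRat`, Néron period with components): inside, `(T+2) ∣ ξ ∣ G` and `G(0) = c♭·t` give `4 ∤ G(0)`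
(K90-V), whence `μ(G) = 0 ∧ λ(G) = 1` (K90-Λ), and p830132 concludes `BSDp W 2`. [cite: GreenbergVatsal2000, p. 4]
[cite: Sprung2017, Thm. 1.12, Cor. 4.4] [cite: Kobayashi2003, Thm. 1.2 (shape)] -/
theorem bsdp_two_of_flatBlindPinch_of_lvalue (W : WeierstrassCurve ℚ) [W.IsElliptic] [W.IsGloballyMinimal]
    (hGZK : rank_eq_analyticRank_of_analyticRank_le_one) (hss : GoodSS W 2) (hL1 : W.entireLFunction 1 ≠ 0)
    [NeZero (W.conductorNorm ℤ)] {f : CuspForm (Gamma0 (W.conductorNorm ℤ)) 2} (hf : IsNewformOf W f)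
    {ϖ : ℚ} (hϖ : (ϖ : ℝ) * W.realPeriodRat = plusPeriod f)
    {Ls Lf : IwasawaAlgebra 2} (hSP : IsSprungPair f 2 (W.frobeniusTrace 2) Ls Lf)
    {ξ G : IwasawaAlgebra 2}
    (hG : iwasawaToPowerSeries 2 G = PowerSeries.C (ϖ : ℚ_[2]) * iwasawaToPowerSeries 2 Lf) (hξG : ξ ∣ G)
    (hK : Finite (W.selmerGroupPInfty 2) →
      ∃ u : ℤ_[2]ˣ, ((PowerSeries.constantCoeff ξ : ℤ_[2]) : ℚ_[2]) =
        ((u : ℤ_[2]) : ℚ_[2]) * ((2 : ℕ) : ℚ_[2]) ^ (padicValNat 2 W.tamagawaProduct) *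
          (Nat.card (W.selmerGroupPInfty 2) : ℚ_[2]))
    (hv : ∀ t : ℚ, W.entireLFunction 1 / (W.realPeriodRat : ℂ) = ((t : ℚ) : ℂ) → padicValRat 2 t ≤ 1)
    (hZ : (PowerSeries.X + PowerSeries.C (2 : ℤ_[2]) : IwasawaAlgebra 2) ∣ ξ) : BSDp W 2 := by
  have hΩpos : 0 < W.realPeriodRat := W.realPeriodRat_pos_holds
  obtain ⟨t, cf, ht, hG0, hcf⟩ := constantCoeff_avatar W hss hf hϖ hSP hG
  have ht0 : t ≠ 0 := by
    intro h0
    apply hL1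
    have h1 := ht
    rw [h0, div_eq_iff (Complex.ofReal_ne_zero.mpr hΩpos.ne')] at h1
    simpa using h1
  have hcf0 : cf ≠ 0 := by rcases hcf with h | h <;> rw [h] <;> norm_num
  have h4 : ¬ (4 : ℤ_[2]) ∣ constantCoeff G := by
    intro h4
    have h4' : ((2 : ℕ) : ℤ_[2]) ^ 2 ∣ constantCoeff G := by
      have he : ((2 : ℕ) : ℤ_[2]) ^ 2 = 4 := by push_cast; norm_num
      rw [he]; exact h4
    have hle := le_padicValRat_of_pow_dvd (p := 2) (mul_ne_zero hcf0 ht0) hG0 h4'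
    rw [padicValRat.mul hcf0 ht0, padicValRat_cf_eq_zero hcf, zero_add] at hle
    have hvt := hv t ht
    push_cast at hle
    omega
  obtain ⟨hμ, hlam⟩ := mu_eq_zero_and_lam_eq_one_of_X_add_C_two_dvd_of_not_four_dvd (hZ.trans hξG) h4
  exact FlatBlindPinch.bsdp_two_of_flatBlindPinch_of_avatar W hGZK hss hL1 hf hϖ hSP hG hξG hK hμ hlam.le hZ

end Summit.BirchSwinnertonDyer.BirchSwinnertonDyer.Cruxes.SupersingularRankZeroAtTwo.D90
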